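import Summits.ResolutionOfSingularities.ResolutionOfSingularities.Theorems.WeightedInvariantContactCylinderEssSmooth
import Summits.ResolutionOfSingularities.ResolutionOfSingularities.Theorems.WeightedInvariantContactCylinderDefs
import Summits.ResolutionOfSingularities.ResolutionOfSingularities.Theorems.WeightedInvariantIotaOrderEssSmooth
import HarnessLib

/-!
# The top `iotaOrd`-stratum and the cylinder `jCylinder iotaOrd jContact` are compatible with essentially smooth local
# homomorphisms — (c11) for the P3a candidate pair, ORDER (o28) (D2)
# (door `HypersurfaceCentreConstruction`, stmt-ResolutionOfSingularities-19897; KEY `stub_localWeightedDropEFT4S` beyond the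
# P2 rung, regime P3a «the top stratum through the closed point is a regular germ of codimension two»)

Topic: `Summits/ResolutionOfSingularities/ResolutionOfSingularities/Theorems`. Helper for the door item
`HypersurfaceCentreConstruction` (stmt-ResolutionOfSingularities-19897, route `WeightedInvariant`), line `local-engine` of
res-L1-w43-plan-1 (L W4.3), ORDER (o28) (lead res-type-005, co-hand res-D-brk-1): the ι-SIDE companion of the (D2) kernel
`ContactCylinder.cylinder_map_compatible` (p525507) and the NAMED WRAPPER over res-type-005's (D1) definitions
`topStratum` / `topStratumPrime` / `jCylinder` (p524206).

## Contents (sorry-free, standard axioms; NO definitions)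

* `iotaOrd_atPrime_eq_iotaOrd_atPrime_comap` — along an essentially smooth local homomorphism `φ : S → S'` of regular
  local rings, for every prime `𝔮'` of `S'` with `𝔮 = 𝔮' ∩ S`: `iotaOrd (S'_{𝔮'}) f = iotaOrd (S_𝔮) f` — the LOCALISED
  homomorphism `S_𝔮 → S'_{𝔮'}` (`Localization.localRingHom`) is again a local, formally smooth (Mathlib
  `FormallySmooth.localization_base`), essentially-of-finite-type homomorphism of regular local rings, so res-type-070's
  `iotaOrd_essSmooth_eq` (p507256) applies to it.  ANY dimension, any regime.
* `mem_topStratum_iotaOrd_map_iff`, **`topStratum_iotaOrd_map`** — `topStratum iotaOrd S' (φ f) = (Spec φ)⁻¹ (topStratum iotaOrd S f)`: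
  the top order-stratum is COMPATIBLE with essentially smooth base change (any dimension);
  `topStratum_iotaOrd_map_of_eq` — if the top stratum of `S` is `V(P)` then that of `S'` is `V(P S')`.
* **`jCylinder_iotaOrd_jContact_map_compatible`** — (c11) for the candidate pair `(iotaOrd, jCylinder iotaOrd jContact)` in
  regime P3a: if the top order-stratum of `S` through the closed point is `V(x, g)` for a pair `x, g ∈ 𝔪_S` with independent
  differentials, and the P2 data hold at `S_{(x,g)}` (`f/1 ≠ 0` not of monomial type, `g/1` a maximiser at `b_max ≥ 1`), then
  `jCylinder iotaOrd jContact S' (φ f) m = (jCylinder iotaOrd jContact S f m) · S'` for every `m`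
  (`topStratum_iotaOrd_map_of_eq` + 005's `jCylinder_eq_of_topStratum_eq` + `cylinder_map_compatible`).

[OURS · L1 W4.3 · (o28) P3a probe]  Replaces the role of NO printed item; NOT a statement of the manuscript
[claim: Hironaka2017, status: under-review]. AI work, weaker than expert review.  Pure commutative algebra; no named facts.

## References

* H. Matsumura, *Commutative Ring Theory* (1987), Thm. 4.3, 19.3, §22 Cor. to Thm. 22.5, Thm. 23.7. [Matsumura1987]
* res-type-005, `plan/tools/res-type-005/o28/P3A-PROBE.md` v2 §5 (OURS, AI design input).
-/

noncomputable section

open IsLocalRing Literature.AlgebraicGeometry.Resolution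
open Summit.ResolutionOfSingularities.ResolutionOfSingularities.Cruxes.HypersurfaceCentreConstruction.LocalEngine

set_option linter.dupNamespace false -- mandated namespace of this single-conjunct summit

namespace Summit.ResolutionOfSingularities.ResolutionOfSingularities.Theorems

namespace ContactCylinder

section EssSmooth

variable (S S' : Type) [CommRing S] [IsRegularLocalRing S] [CommRing S'] [IsRegularLocalRing S'] [Algebra S S']
  [IsLocalHom (algebraMap S S')] [Algebra.FormallySmooth S S'] [Algebra.EssFiniteType S S']

/-! ## The order at a prime of `S'` is the order at its contraction -/

omit [IsLocalHom (algebraMap S S')] in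
/-- **`ord_{S'_{𝔮'}}(f) = ord_{S_{𝔮' ∩ S}}(f)`** along an essentially smooth local homomorphism `S → S'` of regular local
rings, for every prime `𝔮'` of `S'`: the localised homomorphism `S_{𝔮' ∩ S} → S'_{𝔮'}` is a local, formally smooth,
essentially-of-finite-type homomorphism of regular local rings (Mathlib `Localization.localRingHom`,
`FormallySmooth.localization_base`, `EssFiniteType.of_comp`; Matsumura 19.3), and res-type-070's `iotaOrd_essSmooth_eq`
applies to it.  (No `IsLocalHom` hypothesis on `S → S'` is needed here: the localised homomorphism is local by construction.)
[cite: Matsumura1987, §22 Cor. to Thm. 22.5] -/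
theorem iotaOrd_atPrime_eq_iotaOrd_atPrime_comap (f : S) (𝔮' : Ideal S') [𝔮'.IsPrime] :
    iotaOrd (Localization.AtPrime 𝔮') (algebraMap S (Localization.AtPrime 𝔮') f) =
      iotaOrd (Localization.AtPrime (𝔮'.comap (algebraMap S S')))
        (algebraMap S (Localization.AtPrime (𝔮'.comap (algebraMap S S'))) f) := by
  haveI : IsRegularLocalRing (Localization.AtPrime 𝔮') := isRegularLocalRing_localization_atPrime S' 𝔮'
  haveI : IsRegularLocalRing (Localization.AtPrime (𝔮'.comap (algebraMap S S'))) :=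
    isRegularLocalRing_localization_atPrime S _
  letI : Algebra (Localization.AtPrime (𝔮'.comap (algebraMap S S'))) (Localization.AtPrime 𝔮') :=
    (Localization.localRingHom (𝔮'.comap (algebraMap S S')) 𝔮' (algebraMap S S') rfl).toAlgebra
  haveI : IsScalarTower S (Localization.AtPrime (𝔮'.comap (algebraMap S S'))) (Localization.AtPrime 𝔮') :=
    IsScalarTower.of_algebraMap_eq fun s => by
      change _ = Localization.localRingHom (𝔮'.comap (algebraMap S S')) 𝔮' (algebraMap S S') rfl (algebraMap S _ s)
      rw [Localization.localRingHom_to_map, IsScalarTower.algebraMap_apply S S' (Localization.AtPrime 𝔮')]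
  haveI : IsLocalHom (algebraMap (Localization.AtPrime (𝔮'.comap (algebraMap S S'))) (Localization.AtPrime 𝔮')) :=
    Localization.isLocalHom_localRingHom _ 𝔮' (algebraMap S S') rfl
  haveI : Algebra.FormallySmooth S (Localization.AtPrime 𝔮') := Algebra.FormallySmooth.comp S S' _
  haveI : Algebra.EssFiniteType S (Localization.AtPrime 𝔮') := Algebra.EssFiniteType.comp S S' _
  haveI : Algebra.FormallySmooth (Localization.AtPrime (𝔮'.comap (algebraMap S S'))) (Localization.AtPrime 𝔮') :=
    Algebra.FormallySmooth.localization_base (𝔮'.comap (algebraMap S S')).primeCompl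
  haveI : Algebra.EssFiniteType (Localization.AtPrime (𝔮'.comap (algebraMap S S'))) (Localization.AtPrime 𝔮') :=
    Algebra.EssFiniteType.of_comp S _ _
  rw [IsScalarTower.algebraMap_apply S (Localization.AtPrime (𝔮'.comap (algebraMap S S'))) (Localization.AtPrime 𝔮') f]
  exact iotaOrd_essSmooth_eq _ _ _

/-! ## The top order-stratum is compatible with essentially smooth base change -/

/-- A prime `𝔮'` of `S'` lies on the top order-stratum of `φ f` iff its contraction lies on the top order-stratum of `f`
(`iotaOrd_atPrime_eq_iotaOrd_atPrime_comap` at `𝔮'`, res-type-070's `iotaOrd_essSmooth_eq` at the closed points).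
[cite: Matsumura1987, §22 Cor. to Thm. 22.5] -/
theorem mem_topStratum_iotaOrd_map_iff (f : S) (𝔮' : PrimeSpectrum S') :
    𝔮' ∈ topStratum iotaOrd S' (algebraMap S S' f) ↔
      PrimeSpectrum.comap (algebraMap S S') 𝔮' ∈ topStratum iotaOrd S f := by
  rw [mem_topStratum_iff, mem_topStratum_iff, iotaOrd_essSmooth_eq S S' f,
    ← IsScalarTower.algebraMap_apply S S' (Localization.AtPrime 𝔮'.asIdeal) f,
    iotaOrd_atPrime_eq_iotaOrd_atPrime_comap S S' f 𝔮'.asIdeal]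
  exact Iff.rfl

/-- **The top order-stratum is compatible with essentially smooth base change**:
`topStratum iotaOrd S' (φ f) = (Spec φ)⁻¹ (topStratum iotaOrd S f)` (any dimension). [cite: Matsumura1987, §22] -/
theorem topStratum_iotaOrd_map (f : S) :
    topStratum iotaOrd S' (algebraMap S S' f) = PrimeSpectrum.comap (algebraMap S S') ⁻¹' topStratum iotaOrd S f := by
  ext 𝔮'
  exact mem_topStratum_iotaOrd_map_iff S S' f 𝔮'

/-- If the top order-stratum of `S` through the closed point is `V(P)`, that of `S'` is `V(P S')`. [folklore] -/
theorem topStratum_iotaOrd_map_of_eq (f : S) {P : Ideal S} (hE : topStratum iotaOrd S f = {𝔮 | P ≤ 𝔮.asIdeal}) :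
    topStratum iotaOrd S' (algebraMap S S' f) = {𝔮' | P.map (algebraMap S S') ≤ 𝔮'.asIdeal} := by
  ext 𝔮'
  rw [mem_topStratum_iotaOrd_map_iff, hE, Set.mem_setOf_eq, Set.mem_setOf_eq, Ideal.map_le_iff_le_comap]
  exact Iff.rfl

/-- Hence the generic prime of the top order-stratum of `S'` is `P S'` whenever that of `S` is `V(P)` and `P S'` is prime.
[folklore] -/
theorem topStratumPrime_iotaOrd_map_eq (f : S) {P : Ideal S} (hE : topStratum iotaOrd S f = {𝔮 | P ≤ 𝔮.asIdeal})
    [(P.map (algebraMap S S')).IsPrime] :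
    topStratumPrime iotaOrd S' (algebraMap S S' f) = P.map (algebraMap S S') :=
  topStratumPrime_eq_of_topStratum_eq iotaOrd S' _ (topStratum_iotaOrd_map_of_eq S S' f hE)

end EssSmooth

/-! ## (c11) for the candidate pair `(iotaOrd, jCylinder iotaOrd jContact)` in regime P3a -/

/-- **(c11) for the cylinder construction in regime P3a.**  `φ : S → S'` an essentially smooth local homomorphism of regular
local rings; `x, g ∈ 𝔪_S` with independent differentials generating a prime `𝔭 = (x, g)` whose closed set `V(𝔭)` IS the
top order-stratum of `f` through the closed point; the P2 data at `S_𝔭` (`f/1 ≠ 0` not of monomial type, `g/1` a contact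
parameter reaching the terminal level `b_max ≥ 1`).  Then for every `m`:
`jCylinder iotaOrd jContact S' (φ f) m = (jCylinder iotaOrd jContact S f m) · S'` — the cylinder construction of
res-type-005's (D1) EXTENDS along `φ` (the top stratum of `S'` is `V(𝔭 S')`, `𝔭 S' = (φ x, φ g)` prime, and the cylinder
values are compatible by `cylinder_map_compatible`). [OURS · L1 W4.3 · (o28) (D2)] -/
theorem jCylinder_iotaOrd_jContact_map_compatible (S S' : Type) [CommRing S] [IsRegularLocalRing S] [CommRing S']
    [IsRegularLocalRing S'] [Algebra S S'] [IsLocalHom (algebraMap S S')] [Algebra.FormallySmooth S S']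
    [Algebra.EssFiniteType S S'] (x g : S) (hxg : ∀ i, (![x, g] : Fin 2 → S) i ∈ maximalIdeal S)
    (hli : LinearIndependent (ResidueField S) (fun i => (maximalIdeal S).toCotangent ⟨(![x, g] : Fin 2 → S) i, hxg i⟩))
    [(Ideal.span {x, g}).IsPrime] (f : S)
    (hf0 : algebraMap S (Localization.AtPrime (Ideal.span {x, g})) f ≠ 0)
    (hnm : ¬ IsMonomialType (algebraMap S (Localization.AtPrime (Ideal.span {x, g})) f))
    (hreach : algebraMap S (Localization.AtPrime (Ideal.span {x, g})) f ∈
      contactFiltration (algebraMap S (Localization.AtPrime (Ideal.span {x, g})) g)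
        (bMax (algebraMap S (Localization.AtPrime (Ideal.span {x, g})) f))
        (bMax (algebraMap S (Localization.AtPrime (Ideal.span {x, g})) f) *
          (adicOrder (algebraMap S (Localization.AtPrime (Ideal.span {x, g})) f)).toNat))
    (hb : 1 ≤ bMax (algebraMap S (Localization.AtPrime (Ideal.span {x, g})) f))
    (hE : topStratum iotaOrd S f = {𝔮 | Ideal.span {x, g} ≤ 𝔮.asIdeal}) (m : ℕ) :
    jCylinder iotaOrd jContact S' (algebraMap S S' f) m =
      (jCylinder iotaOrd jContact S f m).map (algebraMap S S') := by
  haveI := isPrime_span_pair_map S S' x g hxg hli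
  have hE' : topStratum iotaOrd S' (algebraMap S S' f) =
      {𝔮' | Ideal.span {algebraMap S S' x, algebraMap S S' g} ≤ 𝔮'.asIdeal} := by
    rw [topStratum_iotaOrd_map_of_eq S S' f hE, ← span_pair_map_eq_map S S' x g]
  rw [jCylinder_eq_of_topStratum_eq iotaOrd jContact S' _ m hE', jCylinder_eq_of_topStratum_eq iotaOrd jContact S f m hE,
    ← IsScalarTower.algebraMap_apply S S' _ f]
  exact cylinder_map_compatible S S' x g hxg hli f hf0 hnm hreach hb m

end ContactCylinder

end Summit.ResolutionOfSingularities.ResolutionOfSingularities.Theorems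

end
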